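import Literature.NumberTheory.IwasawaTheory.ClassGroupPRankCentralLayerCriterion
import Literature.NumberTheory.EllipticCurves.FineSelmerTorsionPointFieldMuRoad
import Literature.NumberTheory.EllipticCurves.FineSelmerClassGroupPRankBoundedProofs
import Literature.NumberTheory.EllipticCurves.DivisionFieldUnipotentStabilizer
import Literature.NumberTheory.EllipticCurves.FineSelmerLimThm35Proofs
import HarnessLib

/-!
# Coates–Sujatha's statement (A) from ONE centralised layer: doors fed by the one-layer central criterion
# «`Gal(F_{n+j}/F)` acts trivially on `Cl(F_{n+j})/p`» at `F = K(E[p])`, `F = K(P)` (tame) and `F = ℚ(E[p])^{U_P}` (proved)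

`Proofs`-style file (theorems only: no definition, no named fact, no `sorry`) in topic `NumberTheory/EllipticCurves`,
written by the literature seat `bsd-potss-conjA-anchor` g21 (cell `bsd-potss`; serves the asides stmt-BirchSwinnertonDyer-19386 /
19413 and the record lanes k9-c4 / k8t-c4; closes nothing; (A) is proved for no particular curve — the per-row inputs remain displayed
hypotheses).  Namespaces `Literature.NumberTheory.EllipticCurves.CoatesSujatha2005` (§1, §2) and `…Lim2017` (§3).  Twin of
`FineSelmerSmallRankDoors` (conjA-anchor g20, door L10) with the small-rank input replaced by the CENTRAL-LAYER input (door L11).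

THE INPUT (sibling `IwasawaTheory/ClassGroupPRankCentralLayerCriterion`): for a `ℤ_p`-extension `κ_F` of a number field `F` with
`TotallyRamifiedFrom κ_F n₀`, `n₀ ≤ n`, `1 < p^j - 1`, IF every `F`-automorphism of the layer `F_{n+j}` acts trivially on
`Cl(F_{n+j})/Cl(F_{n+j})^p` THEN the `p`-ranks of all layers are bounded (`exists_forall_classGroupPRank_le_of_classGroup_mulEquiv_trivial`)
and `μ(κ_F) = 0` (`classicalMuVanishes_of_classGroup_mulEquiv_trivial`).  THE DOORS:
* §1 `F = K(E[p])` (Coates–Sujatha Thm. 3.4, bounded-rank form `fineSelmerDual_moduleFinite_of_classGroupPRank_le`);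
* §2 `F = K(P)`, `E[p]` irreducible and tame (the seat's Door L8, `fineSelmerDual_moduleFinite_of_classGroupPRank_stabilizerField_le`);
* §3 `F = ℚ(E[p])^{U_P}` (`K = ℚ`; Lim 2017 Thm. 3.5, tree `thm35_…_holds`).
For `p = 3`, `n = n₀ = 0`, `j = 1` each door reads: **total ramification from `0` and «`Gal(F₁/F)` acts trivially on `Cl(F₁)/3`» ⟹ (A)** —
ONE class group WITH ITS GALOIS ACTION at ONE layer (degree `24` for `F = ℚ(P)` on a normaliser-of-Cartan row), with NO bound on the rank
and growth `F → F₁` allowed (the rows `Cl(F₁)[3] = [3,3]`, `[6,3,3]` of the cell's K9 residue where door L10's `rank₃ ≤ 1` fails: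
kit j329384 found the action trivial on the 406593 and 223587 octics).

References: [CoatesSujatha2005] Thm. 3.4, Lemma 3.8; [Lim2017FineSelmer] §3 Thm. 3.5, Lemma 3.2; [DeoRaySujatha2023] §5 Lemma 5.1;
[Washington1997] §13.3 Lemma 13.18, Prop. 13.22–13.23; [Fukuda1994] Thm. 1; [NeukirchANT1999] Ch. IV §6, Ch. VI §7 Thm. (7.1).
-/

set_option autoImplicit false

noncomputable section

open scoped Classical NumberField
open NumberField Field IntermediateField

namespace Literature.NumberTheory.EllipticCurves.CoatesSujatha2005

open WeierstrassCurve Literature.NumberTheory.IwasawaTheory Literature.NumberTheory.GaloisRepresentations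
  Literature.NumberTheory.EllipticCurves Literature.NumberTheory.EllipticCurves.ZpExtension Literature.NumberTheory.NumberFields

variable {K : Type} [Field K] [NumberField K] (W : WeierstrassCurve K) [W.IsElliptic] {p : ℕ} [Fact p.Prime]

/-! ## §1 At the division field `K(E[p])` -/

/-- **(A) from ONE centralised layer of the cyclotomic tower of `K(E[p])`** (Coates–Sujatha Thm. 3.4 ∘ the one-layer central criterion):
`p` odd, `1 < p^j - 1`; if SOME cyclotomic `ℤ_p`-extension `κ_L` of `L = K(E[p])` is totally ramified above the ramified primes from layer
`n₀`, and every `L`-automorphism of `L_{n+j}` (`n ≥ n₀`) acts trivially on `Cl(L_{n+j})/p`, then statement (A) holds for `E` at `p` over `K_∞`.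
[cite: CoatesSujatha2005, Thm. 3.4] [cite: Washington1997, §13.3 Prop. 13.22–13.23] [cite: NeukirchANT1999, Ch. IV §6 and Ch. VI §7 Thm. (7.1)] -/
theorem conjA_of_classGroup_mulEquiv_trivial_divisionField (hp : p ≠ 2) {n₀ n j : ℕ} (hn : n₀ ≤ n) (hpj : 1 < p ^ j - 1)
    (h : haveI : NeZero p := ⟨(Fact.out : p.Prime).ne_zero⟩
      ∃ κL : ZpExtension ↥(W.divisionField p) p,
        κL.IsCyclotomic ∧ TotallyRamifiedFrom κL n₀ ∧
          ∀ (σ : ↥(κL.layer (n + j)) ≃ₐ[↥(W.divisionField p)] ↥(κL.layer (n + j))) (c : ClassGroup (𝓞 ↥(κL.layer (n + j)))),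
            ClassGroup.mulEquiv (AmbiguousClass.intAut σ) c * c⁻¹ ∈
              (powMonoidHom p : ClassGroup (𝓞 ↥(κL.layer (n + j))) →* ClassGroup (𝓞 ↥(κL.layer (n + j)))).range)
    (κ : ZpExtension K p) (hκ : κ.IsCyclotomic) :
    ∃ (γ : absoluteGaloisGroup K) (D : W.FineSelmerDualData κ γ),
      Module.Finite ℤ_[p] (RestrictScalars ℤ_[p] (IwasawaAlgebra p) D.X) := by
  haveI : NeZero p := ⟨(Fact.out : p.Prime).ne_zero⟩
  haveI : NumberField (W.divisionField p) := NumberField.of_module_finite K _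
  obtain ⟨κL, hκL, hram, hσ⟩ := h
  obtain ⟨B, hB⟩ := exists_forall_classGroupPRank_le_of_classGroup_mulEquiv_trivial κL hram hn hpj hσ
  exact fineSelmerDual_moduleFinite_of_classGroupPRank_le W hp κ hκ B ⟨κL, hκL, hB⟩

/-- **The same with the datum displayed for EVERY cyclotomic `ℤ_p`-extension of `K(E[p])`** (the record lanes' hypothesis shape; a
cyclotomic `ℤ_p`-extension of `K(E[p])` exists — the shifted base change of `κ`). [cite: CoatesSujatha2005, Thm. 3.4]
[cite: Washington1997, §13.3 Prop. 13.22–13.23] [cite: NeukirchANT1999, Ch. IV §6 and Ch. VI §7 Thm. (7.1)] -/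
theorem conjA_of_forall_classGroup_mulEquiv_trivial_divisionField (hp : p ≠ 2) {n₀ n j : ℕ} (hn : n₀ ≤ n) (hpj : 1 < p ^ j - 1)
    (h : haveI : NeZero p := ⟨(Fact.out : p.Prime).ne_zero⟩
      ∀ κL : ZpExtension ↥(W.divisionField p) p, κL.IsCyclotomic →
        TotallyRamifiedFrom κL n₀ ∧
          ∀ (σ : ↥(κL.layer (n + j)) ≃ₐ[↥(W.divisionField p)] ↥(κL.layer (n + j))) (c : ClassGroup (𝓞 ↥(κL.layer (n + j)))),
            ClassGroup.mulEquiv (AmbiguousClass.intAut σ) c * c⁻¹ ∈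
              (powMonoidHom p : ClassGroup (𝓞 ↥(κL.layer (n + j))) →* ClassGroup (𝓞 ↥(κL.layer (n + j)))).range)
    (κ : ZpExtension K p) (hκ : κ.IsCyclotomic) :
    ∃ (γ : absoluteGaloisGroup K) (D : W.FineSelmerDualData κ γ),
      Module.Finite ℤ_[p] (RestrictScalars ℤ_[p] (IwasawaAlgebra p) D.X) := by
  haveI : NeZero p := ⟨(Fact.out : p.Prime).ne_zero⟩
  haveI : NumberField (W.divisionField p) := NumberField.of_module_finite K _
  obtain ⟨a, κ', hs⟩ := exists_zpExtension_shift κ ↥(W.divisionField p)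
  have hκ' : κ'.IsCyclotomic := isCyclotomic_of_shift κ _ κ' hs hκ
  exact conjA_of_classGroup_mulEquiv_trivial_divisionField W hp hn hpj ⟨κ', hκ', (h κ' hκ').1, (h κ' hκ').2⟩ κ hκ

/-- **Layer `n₀ + 1` — the census shape**: `p` odd; if every cyclotomic `ℤ_p`-extension `κ_L` of `L = K(E[p])` has `TotallyRamifiedFrom κ_L n₀`
and every `L`-automorphism of `L_{n₀+1}` acts trivially on `Cl(L_{n₀+1})/p`, then (A) holds for `E` at `p` over `K_∞`.
[cite: CoatesSujatha2005, Thm. 3.4] [cite: Washington1997, §13.3 Prop. 13.22–13.23] [cite: Fukuda1994, Thm. 1 (proof, p. 264)] -/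
theorem conjA_of_forall_classGroup_mulEquiv_trivial_divisionField_succ (hp : p ≠ 2) {n₀ : ℕ}
    (h : haveI : NeZero p := ⟨(Fact.out : p.Prime).ne_zero⟩
      ∀ κL : ZpExtension ↥(W.divisionField p) p, κL.IsCyclotomic →
        TotallyRamifiedFrom κL n₀ ∧
          ∀ (σ : ↥(κL.layer (n₀ + 1)) ≃ₐ[↥(W.divisionField p)] ↥(κL.layer (n₀ + 1))) (c : ClassGroup (𝓞 ↥(κL.layer (n₀ + 1)))),
            ClassGroup.mulEquiv (AmbiguousClass.intAut σ) c * c⁻¹ ∈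
              (powMonoidHom p : ClassGroup (𝓞 ↥(κL.layer (n₀ + 1))) →* ClassGroup (𝓞 ↥(κL.layer (n₀ + 1)))).range)
    (κ : ZpExtension K p) (hκ : κ.IsCyclotomic) :
    ∃ (γ : absoluteGaloisGroup K) (D : W.FineSelmerDualData κ γ),
      Module.Finite ℤ_[p] (RestrictScalars ℤ_[p] (IwasawaAlgebra p) D.X) := by
  haveI : NeZero p := ⟨(Fact.out : p.Prime).ne_zero⟩
  have hp3 : 3 ≤ p := by
    rcases (Fact.out : p.Prime).eq_two_or_odd' with h2 | hodd
    · exact absurd h2 hp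
    · have := (Fact.out : p.Prime).two_le; rcases hodd with ⟨m, rfl⟩; omega
  have hp1 : 1 < p ^ 1 - 1 := by rw [pow_one]; omega
  exact conjA_of_forall_classGroup_mulEquiv_trivial_divisionField W hp (n := n₀) (j := 1) le_rfl hp1 h κ hκ

/-! ## §2 At the torsion-point field `K(P)` (`E[p]` irreducible and tame) -/

omit [NumberField K] [Fact p.Prime] [W.IsElliptic] in
/-- **`K(P) ⊆ K(E[p])`**: the fixed field `K̄^{Stab(P)}` of the stabiliser of a `p`-torsion point lies in the division field `K(E[p]) = K̄^{Γ_{K(E[p])}}`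
(`Γ_{K(E[p])} ≤ Stab(P)`; used to give `K(P)` Fukuda index `0` from `p ∤ #Gal(K(E[p])/K)` in the records).
[cite: SilvermanAEC2009, VIII.§1 (K(E[m]) is the fixed field of the kernel of ρ̄)] -/
theorem fixedField_stabilizer_le_divisionField [NeZero p] (P : ↥(W.geomTorsion (p : ℤ))) :
    fixedField (MulAction.stabilizer (absoluteGaloisGroup K) P) ≤ W.divisionField p := by
  intro x hx
  rw [WeierstrassCurve.divisionField_def, IntermediateField.mem_fixedField_iff]
  rw [IntermediateField.mem_fixedField_iff] at hx
  intro σ hσ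
  have hle : fixingSubgroupOfModule K ↥(W.geomTorsion (p : ℤ)) ≤ MulAction.stabilizer (absoluteGaloisGroup K) P := by
    intro τ hτ
    exact MulAction.mem_stabilizer_iff.mpr ((W.mem_fixingSubgroupOfModule_geomTorsion_iff p).mp hτ P)
  exact hx σ (hle hσ)


/-- **(A) from ONE centralised layer of the cyclotomic tower of `K(P)`** (the seat's Door L8 ∘ the one-layer central criterion): `p` odd,
`E[p]` irreducible and tame (`p ∤ #Gal(K(E[p])/K)`), `P ∈ E[p] ∖ 0`, `K(P) = K̄^{Stab(P)}`, `1 < p^j - 1`; if every (equivalently one)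
cyclotomic `ℤ_p`-extension `κ_P` of `K(P)` has `TotallyRamifiedFrom κ_P n₀` and every `K(P)`-automorphism of `K(P)_{n+j}` (`n ≥ n₀`) acts
trivially on `Cl(K(P)_{n+j})/p`, then (A) holds for `E` at `p`.  `K = ℚ`, `p = 3`, normaliser-of-Cartan rows (`n₀ = 0`, `j = 1`):
«`Gal(ℚ(P)·ℚ₁ / ℚ(P))` acts trivially on `Cl(ℚ(P)·ℚ₁)/3`» (ONE degree-`24` class group with its Galois action) suffices.
[cite: CoatesSujatha2005, §3 Lemma 3.8 and Thm. 3.4] [cite: DeoRaySujatha2023, §5 Lemma 5.1] [cite: Washington1997, §13.3 Prop. 13.22–13.23]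
[cite: NeukirchANT1999, Ch. IV §6 and Ch. VI §7 Thm. (7.1)] -/
theorem conjA_of_classGroup_mulEquiv_trivial_stabilizerField (hp : p ≠ 2) (hirr : W.HasIrreducibleModPGaloisRep p)
    (hG : haveI : NeZero p := ⟨(Fact.out : p.Prime).ne_zero⟩
      ¬ p ∣ Nat.card ((W.divisionField p) ≃ₐ[K] (W.divisionField p)))
    (P : ↥(W.geomTorsion (p : ℤ))) (hP0 : P ≠ 0) {n₀ n j : ℕ} (hn : n₀ ≤ n) (hpj : 1 < p ^ j - 1)
    (h : ∀ κP : ZpExtension ↥(fixedField (MulAction.stabilizer (absoluteGaloisGroup K) P) :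
        IntermediateField K (AlgebraicClosure K)) p,
      κP.IsCyclotomic → TotallyRamifiedFrom κP n₀ ∧
        ∀ (σ : ↥(κP.layer (n + j)) ≃ₐ[↥(fixedField (MulAction.stabilizer (absoluteGaloisGroup K) P) :
              IntermediateField K (AlgebraicClosure K))] ↥(κP.layer (n + j)))
          (c : ClassGroup (𝓞 ↥(κP.layer (n + j)))),
          ClassGroup.mulEquiv (AmbiguousClass.intAut σ) c * c⁻¹ ∈
            (powMonoidHom p : ClassGroup (𝓞 ↥(κP.layer (n + j))) →* ClassGroup (𝓞 ↥(κP.layer (n + j)))).range)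
    (κ : ZpExtension K p) (hκ : κ.IsCyclotomic) :
    ∃ (γ : absoluteGaloisGroup K) (D : W.FineSelmerDualData κ γ),
      Module.Finite ℤ_[p] (RestrictScalars ℤ_[p] (IwasawaAlgebra p) D.X) := by
  have hpr : p.Prime := Fact.out
  haveI : NeZero p := ⟨hpr.ne_zero⟩
  haveI : Finite ↥(W.geomTorsion (p : ℤ)) := W.finite_geomTorsion_nat hpr.ne_zero
  haveI : ContinuousSMul (absoluteGaloisGroup K) ↥(W.geomTorsion (p : ℤ)) :=
    WeierstrassCurve.continuousSMul_geomTorsion W (WeierstrassCurve.isOpen_stabilizer_point_holds W) (p : ℤ)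
  set SP : Subgroup (absoluteGaloisGroup K) := MulAction.stabilizer (absoluteGaloisGroup K) P with hSP
  have hSPopen : IsOpen (SP : Set (absoluteGaloisGroup K)) := stabilizer_isOpen (absoluteGaloisGroup K) P
  set KP : IntermediateField K (AlgebraicClosure K) := fixedField SP with hKP
  haveI : FiniteDimensional K KP := finiteDimensional_fixedField_of_isOpen SP hSPopen
  haveI : NumberField KP := NumberField.of_module_finite K KP
  obtain ⟨a, κ', hs⟩ := exists_zpExtension_shift κ ↥KP
  have hκ' : κ'.IsCyclotomic := isCyclotomic_of_shift κ ↥KP κ' hs hκ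
  obtain ⟨B, hB⟩ := exists_forall_classGroupPRank_le_of_classGroup_mulEquiv_trivial κ' (h κ' hκ').1 hn hpj (h κ' hκ').2
  exact fineSelmerDual_moduleFinite_of_classGroupPRank_stabilizerField_le W hp hirr hG P hP0 κ hκ B ⟨κ', hκ', hB⟩

/-- **Layer `n₀ + 1` at `K(P)` — the census shape**: `p` odd, `E[p]` irreducible and tame, `P ≠ 0`; if every cyclotomic `ℤ_p`-extension
`κ_P` of `K(P)` has `TotallyRamifiedFrom κ_P n₀` and every `K(P)`-automorphism of `K(P)_{n₀+1}` acts trivially on `Cl(K(P)_{n₀+1})/p`,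
then (A) holds for `E` at `p`.  `K = ℚ`, `p = 3`, `n₀ = 0`: **«`Gal(ℚ(P)₁/ℚ(P))` trivial on `Cl(ℚ(P)₁)/3` ⟹ (A)»** — decides the rows
`Cl(ℚ(P)₁)[3] ≅ [3,3]` (rank `2 > 1 = p - 2`, undecided by door L10) when the layer automorphism acts trivially.
[cite: CoatesSujatha2005, §3 Lemma 3.8 and Thm. 3.4] [cite: DeoRaySujatha2023, §5 Lemma 5.1] [cite: Washington1997, §13.3 Prop. 13.22–13.23]
[cite: Fukuda1994, Thm. 1 (proof, p. 264)] -/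
theorem conjA_of_classGroup_mulEquiv_trivial_stabilizerField_succ (hp : p ≠ 2) (hirr : W.HasIrreducibleModPGaloisRep p)
    (hG : haveI : NeZero p := ⟨(Fact.out : p.Prime).ne_zero⟩
      ¬ p ∣ Nat.card ((W.divisionField p) ≃ₐ[K] (W.divisionField p)))
    (P : ↥(W.geomTorsion (p : ℤ))) (hP0 : P ≠ 0) {n₀ : ℕ}
    (h : ∀ κP : ZpExtension ↥(fixedField (MulAction.stabilizer (absoluteGaloisGroup K) P) :
        IntermediateField K (AlgebraicClosure K)) p,
      κP.IsCyclotomic → TotallyRamifiedFrom κP n₀ ∧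
        ∀ (σ : ↥(κP.layer (n₀ + 1)) ≃ₐ[↥(fixedField (MulAction.stabilizer (absoluteGaloisGroup K) P) :
              IntermediateField K (AlgebraicClosure K))] ↥(κP.layer (n₀ + 1)))
          (c : ClassGroup (𝓞 ↥(κP.layer (n₀ + 1)))),
          ClassGroup.mulEquiv (AmbiguousClass.intAut σ) c * c⁻¹ ∈
            (powMonoidHom p : ClassGroup (𝓞 ↥(κP.layer (n₀ + 1))) →* ClassGroup (𝓞 ↥(κP.layer (n₀ + 1)))).range)
    (κ : ZpExtension K p) (hκ : κ.IsCyclotomic) :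
    ∃ (γ : absoluteGaloisGroup K) (D : W.FineSelmerDualData κ γ),
      Module.Finite ℤ_[p] (RestrictScalars ℤ_[p] (IwasawaAlgebra p) D.X) := by
  have hp3 : 3 ≤ p := by
    rcases (Fact.out : p.Prime).eq_two_or_odd' with h2 | hodd
    · exact absurd h2 hp
    · have := (Fact.out : p.Prime).two_le; rcases hodd with ⟨m, rfl⟩; omega
  have hp1 : 1 < p ^ 1 - 1 := by rw [pow_one]; omega
  exact conjA_of_classGroup_mulEquiv_trivial_stabilizerField W hp hirr hG P hP0 (n := n₀) (j := 1) le_rfl hp1 h κ hκ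

end Literature.NumberTheory.EllipticCurves.CoatesSujatha2005

/-! ## §3 At Lim's field `ℚ(E[p])^{U_P}` (`K = ℚ`; any image) -/

namespace Literature.NumberTheory.EllipticCurves.Lim2017

open WeierstrassCurve Literature.NumberTheory.IwasawaTheory IsDedekindDomain NumberField
open Literature.NumberTheory.GaloisRepresentations Literature.NumberTheory.EllipticCurves Literature.NumberTheory.NumberFields

/-- A subfield of the (finite) division field is finite over `ℚ` (bookkeeping). [folklore] -/
private theorem finiteDimensional_of_le_divisionField''' (W : WeierstrassCurve ℚ) [W.IsElliptic] (p : ℕ)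
    [NeZero p] {L : IntermediateField ℚ (AlgebraicClosure ℚ)} (hL : L ≤ W.divisionField p) :
    FiniteDimensional ℚ L :=
  FiniteDimensional.of_injective (IntermediateField.inclusion hL).toLinearMap
    (IntermediateField.inclusion_injective hL)

/-- **(A) from ONE centralised layer of the cyclotomic tower of `L_P = ℚ(E[p])^{U_P}`** (Lim 2017 Thm. 3.5, tree theorem `thm35_…_holds`,
∘ the one-layer central criterion): `p` odd, ANY `P ∈ E[p]`, `1 < p^j - 1`; if every cyclotomic `ℤ_p`-extension `κ_L` of `L_P` has
`TotallyRamifiedFrom κ_L n₀` and every `L_P`-automorphism of `L_{P,n+j}` (`n ≥ n₀`) acts trivially on `Cl(L_{P,n+j})/p`, then statement (A)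
holds for `E` at `p`.  NO image hypothesis.
[cite: Lim2017FineSelmer, §3 Thm. 3.5 and Lemma 3.2 (arXiv:1306.2047 pp. 6–7)] [cite: Washington1997, §13.3 Prop. 13.22–13.23]
[cite: NeukirchANT1999, Ch. IV §6 and Ch. VI §7 Thm. (7.1)] -/
theorem fineSelmerDual_moduleFinite_of_classGroup_mulEquiv_trivial_unipotentStabilizerField
    (W : WeierstrassCurve ℚ) [W.IsElliptic] (p : ℕ) [Fact p.Prime] (hp : p ≠ 2) (P : ↥(W.geomTorsion (p : ℤ))) {n₀ n j : ℕ}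
    (hn : n₀ ≤ n) (hpj : 1 < p ^ j - 1)
    (h : haveI : NeZero p := ⟨(Fact.out : p.Prime).ne_zero⟩
      ∀ κL : ZpExtension (W.unipotentStabilizerField p P) p, κL.IsCyclotomic →
        TotallyRamifiedFrom κL n₀ ∧
          ∀ (σ : ↥(κL.layer (n + j)) ≃ₐ[↥(W.unipotentStabilizerField p P)] ↥(κL.layer (n + j)))
            (c : ClassGroup (𝓞 ↥(κL.layer (n + j)))),
            ClassGroup.mulEquiv (AmbiguousClass.intAut σ) c * c⁻¹ ∈
              (powMonoidHom p : ClassGroup (𝓞 ↥(κL.layer (n + j))) →* ClassGroup (𝓞 ↥(κL.layer (n + j)))).range)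
    (κ : ZpExtension ℚ p) (hκ : κ.IsCyclotomic) :
    ∃ (γ : Field.absoluteGaloisGroup ℚ) (D : W.FineSelmerDualData κ γ),
      Module.Finite ℤ_[p] (RestrictScalars ℤ_[p] (IwasawaAlgebra p) D.X) := by
  haveI : NeZero p := ⟨(Fact.out : p.Prime).ne_zero⟩
  have hL := W.unipotentStabilizerField_le_divisionField p P
  haveI : FiniteDimensional ℚ (W.unipotentStabilizerField p P) := finiteDimensional_of_le_divisionField''' W p hL
  haveI : NumberField (W.unipotentStabilizerField p P) := NumberField.mk
  refine thm35_fineSelmerDual_moduleFinite_of_classicalMuVanishes_of_le_divisionField_holds W p hp _ hL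
    (W.exists_finrank_divisionField_eq_pow_mul_finrank_unipotentStabilizerField p P) ?_ κ hκ
  intro κL hκL
  exact classicalMuVanishes_of_classGroup_mulEquiv_trivial κL (h κL hκL).1 hn hpj (h κL hκL).2

/-- **Layer `n₀ + 1` at `ℚ(E[p])^{U_P}` — the census shape**: `p` odd, any `P`; if every cyclotomic `ℤ_p`-extension `κ_L` of
`L_P = ℚ(E[p])^{U_P}` has `TotallyRamifiedFrom κ_L n₀` and every `L_P`-automorphism of `L_{P,n₀+1}` acts trivially on `Cl(L_{P,n₀+1})/p`,
then (A) holds for `E` at `p`.  NO image hypothesis.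
[cite: Lim2017FineSelmer, §3 Thm. 3.5 and Lemma 3.2 (arXiv:1306.2047 pp. 6–7)] [cite: Washington1997, §13.3 Prop. 13.22–13.23]
[cite: Fukuda1994, Thm. 1 (proof, p. 264)] -/
theorem fineSelmerDual_moduleFinite_of_classGroup_mulEquiv_trivial_succ_unipotentStabilizerField
    (W : WeierstrassCurve ℚ) [W.IsElliptic] (p : ℕ) [Fact p.Prime] (hp : p ≠ 2) (P : ↥(W.geomTorsion (p : ℤ))) {n₀ : ℕ}
    (h : haveI : NeZero p := ⟨(Fact.out : p.Prime).ne_zero⟩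
      ∀ κL : ZpExtension (W.unipotentStabilizerField p P) p, κL.IsCyclotomic →
        TotallyRamifiedFrom κL n₀ ∧
          ∀ (σ : ↥(κL.layer (n₀ + 1)) ≃ₐ[↥(W.unipotentStabilizerField p P)] ↥(κL.layer (n₀ + 1)))
            (c : ClassGroup (𝓞 ↥(κL.layer (n₀ + 1)))),
            ClassGroup.mulEquiv (AmbiguousClass.intAut σ) c * c⁻¹ ∈
              (powMonoidHom p : ClassGroup (𝓞 ↥(κL.layer (n₀ + 1))) →* ClassGroup (𝓞 ↥(κL.layer (n₀ + 1)))).range)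
    (κ : ZpExtension ℚ p) (hκ : κ.IsCyclotomic) :
    ∃ (γ : Field.absoluteGaloisGroup ℚ) (D : W.FineSelmerDualData κ γ),
      Module.Finite ℤ_[p] (RestrictScalars ℤ_[p] (IwasawaAlgebra p) D.X) := by
  have hp3 : 3 ≤ p := by
    rcases (Fact.out : p.Prime).eq_two_or_odd' with h2 | hodd
    · exact absurd h2 hp
    · have := (Fact.out : p.Prime).two_le; rcases hodd with ⟨m, rfl⟩; omega
  have hp1 : 1 < p ^ 1 - 1 := by rw [pow_one]; omega
  exact fineSelmerDual_moduleFinite_of_classGroup_mulEquiv_trivial_unipotentStabilizerField W p hp P (n := n₀) (j := 1)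
    le_rfl hp1 h κ hκ

end Literature.NumberTheory.EllipticCurves.Lim2017

end
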